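import Summits.NavierStokesRegularity.NavierStokesRegularity.Theorems.ExtremiserTransienceTwoThirdsTranslateExcess
import Summits.NavierStokesRegularity.NavierStokesRegularity.Theorems.ExtremiserTransienceTwoThirdsMajorantTools
import Summits.NavierStokesRegularity.NavierStokesRegularity.Theorems.ExtremiserTransienceTwoThirdsThickCells
import HarnessLib

/-!
# Route `ExtremiserTransience`, crux `NearExtremalTransiencePerFlow` (stmt-NavierStokesRegularity-26567),
# LINE g10-1 «two_thirds» (ns-idea-10), stub S1a′ — BRICK 2, step (E2): THE AVERAGED EXCESS MAJORANT `E(τ)`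

`--supports stmt-NavierStokesRegularity-26567` (helper; prover seat ns-net-p2 g13).  This file produces the two inputs `hE`, `hEX`
of `thickUncovered_le_of_excess` (brick 3b) at one scale `s = ρ⁸`: a majorant `E(τ)` of the excess functional of every thick
sub-packing of the translate `τ` of the cell lattice `4ρ⁸ℤ³`, whose average over the cell cube is `≤ C_e (t + 1/(tρ)) · Z`
(`excess_majorant`; `t ∈ (0,1]` free — at `t = ρ^{-1/2}` the rate is `2 C_e ρ^{-1/2}`).  `E(τ)` is AFFINE in two lattice sums of
the finite measure `(|ω|² + |∇ω|²) dx` — the layer sum `Σ_g μ(B(g+τ, ρ⁸+ρ⁷) ∖ B(g+τ, ρ⁸))` and the fat-ball sum `Σ_g μ(B(g+τ, 4ρ⁸))` —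
whose cube averages are `vol(layer)·2Z ≤ (7/(8ρ))·vol(Q)·2Z` and `vol(B_{4ρ⁸})·2Z = 8·(8ρ²⁴ vol B₁)·2Z ≤ 16 vol(Q) Z`; the
remaining quantities of `translate_excess` are bounded pointwise in `τ` (`Σ_c Z_{B(c,2ρ⁸)} ≤ Z`, `Σ_c ∫_{B(c,2ρ⁸)}‖Dw‖² ≤ Z`,
`#F · c_th ≤ Z` by `card_thickCells_mul_le`); the bookkeeping lemmas are in `ExtremiserTransienceTwoThirdsMajorantTools`.
HONEST FRAMING: an averaged excess bound at one scale; nothing about Navier–Stokes is proved; no summit is proved by a line. [folklore]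
-/

noncomputable section

open scoped Topology InnerProductSpace RealInnerProductSpace ENNReal NNReal ContDiff
open MeasureTheory Filter Set Metric
open Literature.Analysis.FluidPDE
open Summit.NavierStokesRegularity.NavierStokesRegularity.Theorems.DepletionLadder.KStar.HalfSpace
open Summit.NavierStokesRegularity.NavierStokesRegularity.Theorems.DepletionLadder.KStar.BangBang
open Summit.NavierStokesRegularity.NavierStokesRegularity.Theorems.NearExtremalTransiencePerFlow.LocalMaximiser

namespace Summit.NavierStokesRegularity.NavierStokesRegularity.Theorems.NearExtremalTransiencePerFlow.TwoThirds

-- the summit's namespace repeats the problem name by convention (D-0017)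
set_option linter.dupNamespace false

/-! ## The majorant -/

/-- **THE AVERAGED EXCESS MAJORANT AT ONE SCALE** (see the module docstring): the inputs `hE`, `hEX` of `thickUncovered_le_of_excess`
with `e₀ = C_e (t + 1/(tρ)) Z`. [folklore] -/
theorem excess_majorant (A : ℕ → ℝ) (hA : ∀ j, 1 ≤ A j) (A_E θ₀ : ℝ) (hAE : 0 ≤ A_E) (hθ₀ : 0 < θ₀) :
    ∃ Ce : ℝ, 0 ≤ Ce ∧ ∀ (w : E3 → E3) (B ρ t : ℝ), IsAdm w 1 B → IsReg A w 1 → 0 < Zen w → lam w = 1 → HasLinearGrowth A_E w →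
    2 ≤ ρ → 0 < t → t ≤ 1 →
    ∀ b : Module.Basis (Fin 3) ℝ E3, (∀ x : E3, x ∈ ZSpan.fundamentalDomain b ↔ ∀ j, x j ∈ Set.Ico 0 (4 * ρ ^ 8)) →
    (∀ x : E3, x ∈ Submodule.span ℤ (Set.range b) ↔ ∀ j, ∃ n : ℤ, x j = 4 * ρ ^ 8 * n) →
    ∃ E : E3 → ℝ≥0∞,
      (∫⁻ τ in ZSpan.fundamentalDomain b, E τ ≤ ENNReal.ofReal (Ce * (t + 1 / (t * ρ)) * Zen w) * volume (ZSpan.fundamentalDomain b)) ∧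
      ∀ τ ∈ ZSpan.fundamentalDomain b, E τ ≠ ⊤ → ∀ F : Finset E3, (∀ c ∈ F, c - τ ∈ Submodule.span ℤ (Set.range b)) →
        (∀ c ∈ F, ({x | θ₀ ≤ ‖curl w x‖} ∩ ball c (ρ ^ 8 / 2)).Nonempty) →
        (∑ c ∈ F, max (Jb w c (ρ ^ 8) - kStar * Real.sqrt (Zb w c (ρ ^ 8) * Wb w c (ρ ^ 8))) 0) +
          max ((∫ x in (⋃ c ∈ F, ball c (ρ ^ 8))ᶜ, sd w x) -
            kStar * Real.sqrt ((∫ x in (⋃ c ∈ F, ball c (ρ ^ 8))ᶜ, zd w x) * (∫ x in (⋃ c ∈ F, ball c (ρ ^ 8))ᶜ, wd w x))) 0 ≤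
          (E τ).toReal := by
  have hA1 : 0 ≤ A 1 := by linarith [hA 1]
  have hA2 : 1 ≤ A 2 := hA 2
  obtain ⟨Cc, hCc0, hte⟩ := translate_excess (A 1) A_E hA1 hAE
  -- the thick-cell constant
  obtain ⟨cth, hcth⟩ : ∃ cth : ℝ, cth = (θ₀ / 2) ^ 2 * (volume : Measure E3).real (Metric.ball (0 : E3) (min (θ₀ / (8 * A 2)) (1 / 2))) :=
    ⟨_, rfl⟩
  have hcth0 : 0 < cth := by
    have hr : 0 < min (θ₀ / (8 * A 2)) (1 / 2) := lt_min (by have := lt_of_lt_of_le one_pos hA2; positivity) (by norm_num)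
    have hvol : 0 < (volume : Measure E3).real (Metric.ball (0 : E3) (min (θ₀ / (8 * A 2)) (1 / 2))) :=
      ENNReal.toReal_pos (measure_ball_pos volume _ hr).ne' measure_ball_lt_top.ne
    rw [hcth]; positivity
  have hκ : 0 ≤ kStar := kStar_pos.le
  obtain ⟨Ce, hCe⟩ : ∃ Ce : ℝ, Ce = kStar + kStar * Cc + Cc + (6 * kStar * Cc ^ 2 + 12 * kStar * Cc) * (18 + 1 / cth) +
      (2 * kStar * Cc ^ 2 + 4 * kStar * Cc + 4 * A 1 * Cc + 4 * Cc ^ 2) * (1 / cth) + 7 / 4 * (2 * kStar * Cc + 4 * kStar + 5 * A 1 + 4 * Cc) :=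
    ⟨_, rfl⟩
  have hCe0 : 0 ≤ Ce := by rw [hCe]; positivity
  refine ⟨Ce, hCe0, fun w B ρ t hadm hreg hZ hlam hgr hρ ht ht1 b hbQ hbΛ => ?_⟩
  obtain ⟨hv, hdiv, hvM, -, h0, h1, h2⟩ := id hadm
  have hρ0 : 0 < ρ := by linarith
  have hs : 0 < ρ ^ 8 := by positivity
  have hs1 : 1 ≤ ρ ^ 8 := one_le_pow₀ (by linarith)
  have hρ7 : 0 ≤ ρ ^ 7 := by positivity
  have hv2 : ContDiff ℝ 2 w := hv.of_le (by norm_cast)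
  have hv3 : ContDiff ℝ 3 w := hv.of_le (by norm_cast)
  have hDw : ∀ x, ‖fderiv ℝ w x‖ ≤ A 1 := fun x => by
    have h := hreg 1 x
    rw [hlam, inv_one, one_pow, mul_one, mul_one, norm_iteratedFDeriv_one] at h
    exact h
  have hWZ : Wpa w = Zen w := by
    have h : Real.sqrt (Zen w / Wpa w) = 1 := hlam
    have h2' : Zen w / Wpa w = 1 := Real.sqrt_eq_one.1 h
    by_cases hW0 : Wpa w = 0
    · rw [hW0, div_zero] at h2'; exact absurd h2' zero_ne_one
    · field_simp at h2'; linarith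
  have izd : Integrable (zd w) := (integrable_norm_curl_sq hv2 h1).1
  have iwd : Integrable (wd w) := (integrable_frobeniusNormSq_fderiv_curl hv3 h2).1
  have hi : Integrable (fun x => zd w x + wd w x) := izd.add iwd
  obtain ⟨hDint, hDle⟩ := integral_norm_fderiv_sq_le_Zen hv hdiv h0 h1
  -- the finite measure `(|ω|² + |∇ω|²) dx`, its two lattice sums, and `E`
  set μb : Measure E3 := volume.withDensity (fun x => ENNReal.ofReal (zd w x + wd w x)) with hμb
  haveI : IsFiniteMeasure μb := isFiniteMeasure_withDensity_ofReal hi.hasFiniteIntegral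
  set Q : Set E3 := ZSpan.fundamentalDomain b with hQ
  set Λ := (Submodule.span ℤ (Set.range b)).toAddSubgroup with hΛ
  set L : E3 → ℝ≥0∞ := fun τ => ∑' g : Λ, (μb (ball ((g : E3) + τ) (ρ ^ 8 + ρ ^ 7)) - μb (ball ((g : E3) + τ) (ρ ^ 8))) with hL
  set Φ : E3 → ℝ≥0∞ := fun τ => ∑' g : Λ, (μb (ball ((g : E3) + τ) (4 * ρ ^ 8)) - μb (ball ((g : E3) + τ) 0)) with hΦ
  have hLm : Measurable L := measurable_tsum_layer μb b (ρ ^ 8) (ρ ^ 8 + ρ ^ 7)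
  have hΦm : Measurable Φ := measurable_tsum_layer μb b 0 (4 * ρ ^ 8)
  obtain ⟨βL, hβL⟩ : ∃ βL : ℝ, βL = 2 * (kStar * (Cc / ρ ^ 2)) + 4 * kStar * (1 / (2 * t) + 1 / 2) + 5 * A 1 + 4 * (Cc / ρ ^ 2) := ⟨_, rfl⟩
  obtain ⟨β₄, hβ₄⟩ : ∃ β₄ : ℝ, β₄ = 6 * kStar * (Cc / ρ ^ 2) ^ 2 + 12 * kStar * (1 / (2 * t) + 1 / 2) * (Cc / ρ ^ 2) := ⟨_, rfl⟩
  obtain ⟨cN, hcN⟩ : ∃ cN : ℝ, cN = kStar * (Cc / ρ ^ 2) ^ 2 + 2 * kStar * (1 / (2 * t) + 1 / 2) * (Cc / ρ ^ 2) + 2 * A 1 * (Cc / ρ ^ 2) +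
      2 * (Cc / ρ ^ 2) ^ 2 := ⟨_, rfl⟩
  obtain ⟨G₀, hG₀⟩ : ∃ G₀ : ℝ, G₀ = (kStar * (Cc / ρ ^ 2) + kStar * t + Cc / ρ ^ 2) + β₄ * (2 + 1 / cth) + 2 * cN * (1 / cth) := ⟨_, rfl⟩
  have hct0 : 0 ≤ 1 / (2 * t) + 1 / 2 := by positivity
  have hm0 : 0 ≤ Cc / ρ ^ 2 := by positivity
  have hβLpos : 0 < βL := by
    rw [hβL]
    have : 0 < 4 * kStar * (1 / (2 * t) + 1 / 2) := by have := kStar_pos; positivity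
    positivity
  have hβ₄0 : 0 ≤ β₄ := by rw [hβ₄]; positivity
  have hcN0 : 0 ≤ cN := by rw [hcN]; positivity
  have hG₀0 : 0 ≤ G₀ := by rw [hG₀]; positivity
  set E : E3 → ℝ≥0∞ := fun τ => ENNReal.ofReal (G₀ * Zen w) + ENNReal.ofReal βL * L τ + ENNReal.ofReal β₄ * Φ τ with hE
  refine ⟨E, ?_, ?_⟩
  · -- ### the average of `E` over the cell cube
    have hμb_univ : μb Set.univ = ENNReal.ofReal (Zen w + Wpa w) := by
      rw [hμb, withDensity_apply _ MeasurableSet.univ, Measure.restrict_univ,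
        ← ofReal_integral_eq_lintegral_ofReal hi (Eventually.of_forall fun x => add_nonneg (sq_nonneg _) (frobeniusNormSq_nonneg _)),
        integral_add izd iwd]
      rfl
    have hQvol : ENNReal.ofReal (8 * (ρ ^ 8) ^ 3) * volume (ball (0 : E3) 1) ≤ volume Q := by
      have hQset : Q = {x : E3 | ∀ j, x j ∈ Set.Ico 0 (4 * ρ ^ 8)} := Set.ext hbQ
      rw [hQset, show 8 * (ρ ^ 8) ^ 3 = (2 * ρ ^ 8) ^ 3 by ring]
      have h := Measure.addHaar_ball_of_pos volume (0 : E3) (by positivity : (0 : ℝ) < 2 * ρ ^ 8)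
      rw [finrank_euclideanSpace, Fintype.card_fin] at h
      rw [← h]
      exact volume_ball_two_mul_le_cellCube
    have hLint : ∫⁻ τ in Q, L τ ≤ ENNReal.ofReal (7 / (8 * ρ)) * volume Q * ENNReal.ofReal (Zen w + Wpa w) := by
      rw [hL, hQ, hΛ, setLIntegral_tsum_lattice_layer_eq μb (by linarith : ρ ^ 8 ≤ ρ ^ 8 + ρ ^ 7) b, hμb_univ]
      refine mul_le_mul' ((layer_volume_le hρ).trans ?_) le_rfl
      exact mul_le_mul' le_rfl hQvol
    have hΦint : ∫⁻ τ in Q, Φ τ ≤ ENNReal.ofReal 8 * volume Q * ENNReal.ofReal (Zen w + Wpa w) := by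
      rw [hΦ, hQ, hΛ, setLIntegral_tsum_lattice_layer_eq μb (by positivity : (0 : ℝ) ≤ 4 * ρ ^ 8) b, hμb_univ, fat_volume_eq hρ]
      refine mul_le_mul' ?_ le_rfl
      exact mul_le_mul' le_rfl hQvol
    have hsplit : ∫⁻ τ in Q, E τ = ENNReal.ofReal (G₀ * Zen w) * volume Q + ENNReal.ofReal βL * (∫⁻ τ in Q, L τ) +
        ENNReal.ofReal β₄ * (∫⁻ τ in Q, Φ τ) := by
      show ∫⁻ τ in Q, (ENNReal.ofReal (G₀ * Zen w) + ENNReal.ofReal βL * L τ + ENNReal.ofReal β₄ * Φ τ) = _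
      rw [lintegral_add_right _ (hΦm.const_mul _), lintegral_add_right _ (hLm.const_mul _), setLIntegral_const,
        lintegral_const_mul _ hLm, lintegral_const_mul _ hΦm]
    rw [hsplit]
    have hrate := rate_le (κ := kStar) (Cc := Cc) (A₁ := A 1) hκ hCc0 hA1 hcth0 hρ ht ht1
    rw [← hCe, ← hβL, ← hβ₄, ← hcN] at hrate
    have hreal : G₀ * Zen w + βL * (7 / (8 * ρ) * (Zen w + Wpa w)) + β₄ * (8 * (Zen w + Wpa w)) ≤ Ce * (t + 1 / (t * ρ)) * Zen w := by
      rw [hWZ, hG₀]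
      have hmul := mul_le_mul_of_nonneg_right hrate hZ.le
      linarith only [hmul]
    have hZW : 0 ≤ Zen w + Wpa w := by rw [hWZ]; linarith
    have eq1 : ENNReal.ofReal (G₀ * Zen w) + ENNReal.ofReal βL * (ENNReal.ofReal (7 / (8 * ρ)) * ENNReal.ofReal (Zen w + Wpa w)) +
        ENNReal.ofReal β₄ * (ENNReal.ofReal 8 * ENNReal.ofReal (Zen w + Wpa w)) =
        ENNReal.ofReal (G₀ * Zen w + βL * (7 / (8 * ρ) * (Zen w + Wpa w)) + β₄ * (8 * (Zen w + Wpa w))) := by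
      rw [← ENNReal.ofReal_mul (by positivity : (0 : ℝ) ≤ 7 / (8 * ρ)), ← ENNReal.ofReal_mul hβLpos.le,
        ← ENNReal.ofReal_mul (by norm_num : (0 : ℝ) ≤ 8), ← ENNReal.ofReal_mul hβ₄0,
        ← ENNReal.ofReal_add (mul_nonneg hG₀0 hZ.le) (mul_nonneg hβLpos.le (mul_nonneg (by positivity) hZW)),
        ← ENNReal.ofReal_add (add_nonneg (mul_nonneg hG₀0 hZ.le) (mul_nonneg hβLpos.le (mul_nonneg (by positivity) hZW)))
          (mul_nonneg hβ₄0 (mul_nonneg (by norm_num) hZW))]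
    calc ENNReal.ofReal (G₀ * Zen w) * volume Q + ENNReal.ofReal βL * (∫⁻ τ in Q, L τ) + ENNReal.ofReal β₄ * (∫⁻ τ in Q, Φ τ)
        ≤ ENNReal.ofReal (G₀ * Zen w) * volume Q + ENNReal.ofReal βL * (ENNReal.ofReal (7 / (8 * ρ)) * volume Q * ENNReal.ofReal (Zen w + Wpa w)) +
          ENNReal.ofReal β₄ * (ENNReal.ofReal 8 * volume Q * ENNReal.ofReal (Zen w + Wpa w)) :=
          add_le_add (add_le_add le_rfl (mul_le_mul' le_rfl hLint)) (mul_le_mul' le_rfl hΦint)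
      _ = (ENNReal.ofReal (G₀ * Zen w) + ENNReal.ofReal βL * (ENNReal.ofReal (7 / (8 * ρ)) * ENNReal.ofReal (Zen w + Wpa w)) +
          ENNReal.ofReal β₄ * (ENNReal.ofReal 8 * ENNReal.ofReal (Zen w + Wpa w))) * volume Q := by ring
      _ = ENNReal.ofReal (G₀ * Zen w + βL * (7 / (8 * ρ) * (Zen w + Wpa w)) + β₄ * (8 * (Zen w + Wpa w))) * volume Q := by rw [eq1]
      _ ≤ ENNReal.ofReal (Ce * (t + 1 / (t * ρ)) * Zen w) * volume Q := mul_le_mul' (ENNReal.ofReal_le_ofReal hreal) le_rfl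
  · -- ### the excess of every thick sub-packing of the translate `τ`
    intro τ _ hEτ F hFΛ hthick
    -- separation of the cells
    have hsep : ∀ c ∈ F, ∀ c' ∈ F, c ≠ c' → 4 * ρ ^ 8 ≤ dist c c' := by
      intro c hc c' hc' hne
      have hg := (hbΛ _).1 (hFΛ c hc)
      have hg' := (hbΛ _).1 (hFΛ c' hc')
      have h := dist_ge_of_mem_cellLattice hs hg hg' (fun h => hne (sub_left_injective h))
      rwa [dist_sub_right] at h
    have hsep2 : ∀ c ∈ F, ∀ c' ∈ F, c ≠ c' → 2 * (2 * ρ ^ 8) ≤ dist c c' := fun c hc c' hc' hne => by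
      linarith [hsep c hc c' hc' hne]
    -- the linear bound of `translate_excess`
    have hT := hte w F ρ t hv hdiv hvM hDw hgr h0 h1 h2 hρ ht hsep
    simp only [Finset.sum_add_distrib, Finset.sum_const, nsmul_eq_mul, mul_one] at hT
    -- `(E τ).toReal`
    have hEτeq : E τ = ENNReal.ofReal (G₀ * Zen w) + ENNReal.ofReal βL * L τ + ENNReal.ofReal β₄ * Φ τ := rfl
    have hLfin : L τ ≠ ⊤ := by
      intro htop
      apply hEτ
      rw [hEτeq, htop, ENNReal.mul_top (ne_of_gt (ENNReal.ofReal_pos.2 hβLpos)), add_top, top_add]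
    have h2' : ENNReal.ofReal β₄ * Φ τ ≠ ⊤ := by
      intro htop
      apply hEτ
      rw [hEτeq, htop, add_top]
    have hEτ' : (E τ).toReal = G₀ * Zen w + βL * (L τ).toReal + β₄ * (Φ τ).toReal := by
      have h1' : ENNReal.ofReal (G₀ * Zen w) + ENNReal.ofReal βL * L τ ≠ ⊤ :=
        ENNReal.add_ne_top.2 ⟨ENNReal.ofReal_ne_top, ENNReal.mul_ne_top ENNReal.ofReal_ne_top hLfin⟩
      rw [hEτeq, ENNReal.toReal_add h1' h2', ENNReal.toReal_add ENNReal.ofReal_ne_top (ENNReal.mul_ne_top ENNReal.ofReal_ne_top hLfin),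
        ENNReal.toReal_mul, ENNReal.toReal_mul, ENNReal.toReal_ofReal (by positivity), ENNReal.toReal_ofReal hβLpos.le,
        ENNReal.toReal_ofReal hβ₄0]
    -- the layer sums against `L τ`
    have hlay0 : ∀ c : E3, 0 ≤ (Zb w c (ρ ^ 8 + ρ ^ 7) + Wb w c (ρ ^ 8 + ρ ^ 7)) - (Zb w c (ρ ^ 8) + Wb w c (ρ ^ 8)) := fun c => by
      have hsub : ball c (ρ ^ 8) ⊆ ball c (ρ ^ 8 + ρ ^ 7) := ball_subset_ball (by linarith)
      linarith [Zb_mono hv hsub, Wb_mono hv hsub]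
    have hlayer : ∑ c ∈ F, ((Zb w c (ρ ^ 8 + ρ ^ 7) + Wb w c (ρ ^ 8 + ρ ^ 7)) - (Zb w c (ρ ^ 8) + Wb w c (ρ ^ 8))) ≤ (L τ).toReal := by
      rw [← ENNReal.ofReal_le_iff_le_toReal hLfin, ENNReal.ofReal_sum_of_nonneg (fun c _ => hlay0 c)]
      calc ∑ c ∈ F, ENNReal.ofReal ((Zb w c (ρ ^ 8 + ρ ^ 7) + Wb w c (ρ ^ 8 + ρ ^ 7)) - (Zb w c (ρ ^ 8) + Wb w c (ρ ^ 8)))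
          = ∑ c ∈ F, (μb (ball c (ρ ^ 8 + ρ ^ 7)) - μb (ball c (ρ ^ 8))) :=
            Finset.sum_congr rfl fun c _ => by rw [hμb]; exact ofReal_layer_eq izd iwd hv c (by linarith)
        _ ≤ L τ := sum_le_tsum_translate Λ τ F hFΛ (fun c => μb (ball c (ρ ^ 8 + ρ ^ 7)) - μb (ball c (ρ ^ 8)))
    -- the fat balls against `Φ τ` (needed only when `β₄ > 0`)
    have hfat : Φ τ ≠ ⊤ → ∑ c ∈ F, Zb w c (4 * ρ ^ 8) ≤ (Φ τ).toReal := fun hΦfin => by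
      have hnn : ∀ c : E3, 0 ≤ (Zb w c (4 * ρ ^ 8) + Wb w c (4 * ρ ^ 8)) - (Zb w c 0 + Wb w c 0) := fun c => by
        have hsub : ball c 0 ⊆ ball c (4 * ρ ^ 8) := ball_subset_ball (by positivity)
        linarith [Zb_mono hv hsub, Wb_mono hv hsub]
      have hle : ∑ c ∈ F, Zb w c (4 * ρ ^ 8) ≤ ∑ c ∈ F, ((Zb w c (4 * ρ ^ 8) + Wb w c (4 * ρ ^ 8)) - (Zb w c 0 + Wb w c 0)) := by
        refine Finset.sum_le_sum fun c _ => ?_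
        have hZ0' : Zb w c 0 = 0 := by unfold Zb; rw [Metric.ball_zero, Measure.restrict_empty, integral_zero_measure]
        have hW0' : Wb w c 0 = 0 := by unfold Wb; rw [Metric.ball_zero, Measure.restrict_empty, integral_zero_measure]
        rw [hZ0', hW0']; linarith [Wb_nonneg w c (4 * ρ ^ 8)]
      refine hle.trans ?_
      rw [← ENNReal.ofReal_le_iff_le_toReal hΦfin, ENNReal.ofReal_sum_of_nonneg (fun c _ => hnn c)]
      calc ∑ c ∈ F, ENNReal.ofReal ((Zb w c (4 * ρ ^ 8) + Wb w c (4 * ρ ^ 8)) - (Zb w c 0 + Wb w c 0))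
          = ∑ c ∈ F, (μb (ball c (4 * ρ ^ 8)) - μb (ball c 0)) :=
            Finset.sum_congr rfl fun c _ => by rw [hμb]; exact ofReal_layer_eq izd iwd hv c (by positivity)
        _ ≤ Φ τ := sum_le_tsum_translate Λ τ F hFΛ (fun c => μb (ball c (4 * ρ ^ 8)) - μb (ball c 0))
    have m3 : β₄ * ∑ c ∈ F, Zb w c (4 * ρ ^ 8) ≤ β₄ * (Φ τ).toReal := by
      rcases eq_or_lt_of_le hβ₄0 with hb0 | hb0
      · rw [← hb0, zero_mul, zero_mul]
      · have hΦfin : Φ τ ≠ ⊤ := by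
          intro htop
          apply h2'
          rw [htop, ENNReal.mul_top (ne_of_gt (ENNReal.ofReal_pos.2 hb0))]
        exact mul_le_mul_of_nonneg_left (hfat hΦfin) hβ₄0
    -- pointwise-in-`τ` sums
    have hZ2 : ∑ c ∈ F, Zb w c (2 * ρ ^ 8) ≤ Zen w := sum_setIntegral_ball_le izd (fun x => sq_nonneg _) F hsep2
    have hD2 : ∑ c ∈ F, ∫ x in ball c (2 * ρ ^ 8), ‖fderiv ℝ w x‖ ^ 2 ≤ Zen w :=
      (sum_setIntegral_ball_le hDint (fun x => sq_nonneg _) F hsep2).trans hDle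
    have hthick' : ∀ c ∈ F, ∃ x, dist x c < ρ ^ 8 / 2 ∧ θ₀ ≤ ‖curl w x‖ := fun c hc => by
      obtain ⟨x, hx1, hx2⟩ := hthick c hc
      exact ⟨x, mem_ball.1 hx2, hx1⟩
    have hN : (F.card : ℝ) * cth ≤ Zen w := by
      rw [hcth]; exact card_thickCells_mul_le hadm hreg hlam hA2 hθ₀ hs1 F hsep hthick'
    have hN' : (F.card : ℝ) ≤ Zen w * (1 / cth) := by
      have hid : (F.card : ℝ) = F.card * cth * (1 / cth) := by rw [mul_assoc, mul_one_div_cancel hcth0.ne', mul_one]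
      rw [hid]; exact mul_le_mul_of_nonneg_right hN (by positivity)
    have hN0 : (0 : ℝ) ≤ F.card := Nat.cast_nonneg _
    -- products for the final linear combination
    have hsumZL0 : 0 ≤ ∑ c ∈ F, (Zb w c (ρ ^ 8 + ρ ^ 7) - Zb w c (ρ ^ 8)) := Finset.sum_nonneg fun c _ => by
      linarith [Zb_mono hv (ball_subset_ball (by linarith) : ball c (ρ ^ 8) ⊆ ball c (ρ ^ 8 + ρ ^ 7))]
    have hsumWL0 : 0 ≤ ∑ c ∈ F, (Wb w c (ρ ^ 8 + ρ ^ 7) - Wb w c (ρ ^ 8)) := Finset.sum_nonneg fun c _ => by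
      linarith [Wb_mono hv (ball_subset_ball (by linarith) : ball c (ρ ^ 8) ⊆ ball c (ρ ^ 8 + ρ ^ 7))]
    have hsumZ40 : 0 ≤ ∑ c ∈ F, Zb w c (4 * ρ ^ 8) := Finset.sum_nonneg fun c _ => Zb_nonneg w c _
    have hlayer' : (∑ c ∈ F, (Zb w c (ρ ^ 8 + ρ ^ 7) - Zb w c (ρ ^ 8))) + ∑ c ∈ F, (Wb w c (ρ ^ 8 + ρ ^ 7) - Wb w c (ρ ^ 8)) ≤ (L τ).toReal := by
      rw [← Finset.sum_add_distrib]
      refine le_trans (le_of_eq (Finset.sum_congr rfl fun c _ => by ring)) hlayer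
    have m1 : (2 * (kStar * (Cc / ρ ^ 2)) + 4 * kStar * (1 / (2 * t) + 1 / 2)) * ∑ c ∈ F, (Wb w c (ρ ^ 8 + ρ ^ 7) - Wb w c (ρ ^ 8)) ≤
        βL * ∑ c ∈ F, (Wb w c (ρ ^ 8 + ρ ^ 7) - Wb w c (ρ ^ 8)) :=
      mul_le_mul_of_nonneg_right (by rw [hβL]; linarith [mul_nonneg hA1 zero_le_one]) hsumWL0
    have m2 := mul_le_mul_of_nonneg_left hlayer' hβLpos.le
    have m4 := mul_le_mul_of_nonneg_left hZ2 hβ₄0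
    have m5 := mul_le_mul_of_nonneg_left hD2 hβ₄0
    have m6 := mul_le_mul_of_nonneg_left hN' hβ₄0
    have m7 := mul_le_mul_of_nonneg_left hN' hcN0
    rw [← hβL, ← hβ₄, ← hcN, hWZ] at hT
    rw [hEτ', hG₀]
    linarith only [hT, m1, m2, m3, m4, m5, m6, m7]

end Summit.NavierStokesRegularity.NavierStokesRegularity.Theorems.NearExtremalTransiencePerFlow.TwoThirds

end
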